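import Summits.Ventures.PercRepro.C025ProfileGirthRows
import Summits.Ventures.PercRepro.C025ProfileHallGirth

/-!
# THE HALL FORM `(H⁺_{q,u})` AT GIRTH `≥ u` (night-3 g18)

`C025ProfileGirthRows` proves the row `(q, u)` of `(Π)` on every matroid in which every set of at most `u − 1` points is
independent, `q ≤ u − 2`, by the injection `C ↦ C ∪ {y_C}` of the `u`-circuits into the `(u+1)`-sets of rank `u`.  The same
injection, applied inside the BOOLEAN upper shadow of a family `𝒜` of `q`-sets (g7's `Boolean.upAt`), gives the HALL FORM
(C-033) at the same girth: the Boolean shadow at the level `u` splits into its independent members (rank-`u` sets above `𝒜`)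
and the `u`-circuits `C ⊇ B ∈ 𝒜`, whose images `C ∪ {y_C}` are rank-`u` sets above `𝒜` of `u + 1` points; so the matroid
shadow is at least as large as the Boolean one, and g7's normalized matching property of the Boolean lattice
(`Boolean.card_mul_choose_le_card_upAt_mul_choose`) together with g6's price bound finishes, exactly as in g7's
`hallIneq_of_girth` (which needs every set of at most `u` points independent).
* `card_le_card_of_girth_family` — the injection argument for an arbitrary family of `(v+1)`-subsets of the ground set;
* **`card_upAt_le_card_shadowLevel`** — the Boolean shadow at the level `v + 1` is at most the matroid shadow;
* **`hallIneq_of_girth_succ`** `(hg : ∀ T ⊆ M.E, T.encard ≤ v → M.Indep T) (hqv : q + 1 ≤ v) : Profile.HallIneq M q (v + 1)`;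
* `profileIneq_and_hallIneq_of_girth_succ` — the row and its Hall form together.
No `def`, no `instance`, no notation.  Axioms: standard.
-/

open scoped Matroid

namespace PercRepro

open Set Finset ThmH Staged

namespace GirthRows

variable {α : Type} [DecidableEq α] {M : Matroid α} [M.Finite]

/-- **The injection argument for a family**: if every set of at most `v` points is independent and `ρ(E) ≥ v + 1`, then a
family `P` of `(v+1)`-subsets of the ground set injects into any family `L` that contains the independent members of `P`
and, for every dependent member `S` of `P` and every `y ∈ E ∖ cl(S)`, the set `S ∪ {y}`. -/
theorem card_le_card_of_girth_family {v : ℕ} (hg : ∀ T ⊆ M.E, T.encard ≤ v → M.Indep T)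
    (hrank : ((v + 1 : ℕ) : ℕ∞) ≤ M.eRank) {P L : Finset (Finset α)}
    (hP : P ⊆ Finset.powersetCard (v + 1) (gr M))
    (hL1 : ∀ S ∈ P, M.Indep (S : Set α) → S ∈ L)
    (hL2 : ∀ S ∈ P, ¬ M.Indep (S : Set α) → ∀ y ∈ gr M, y ∉ M.closure (S : Set α) → insert y S ∈ L) :
    P.card ≤ L.card := by
  classical
  set I := P.filter (fun S : Finset α => M.Indep (S : Set α)) with hI
  set D := P.filter (fun S : Finset α => ¬ M.Indep (S : Set α)) with hD
  have hID : I.card + D.card = P.card := by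
    rw [hI, hD]
    exact Finset.card_filter_add_card_filter_not _
  have hDmem : ∀ S ∈ D, S ∈ P ∧ S ⊆ gr M ∧ S.card = v + 1 ∧ ¬ M.Indep (S : Set α) := by
    intro S hS
    rw [hD, Finset.mem_filter] at hS
    have h := Finset.mem_powersetCard.1 (hP hS.1)
    exact ⟨hS.1, h.1, h.2, hS.2⟩
  have hDrk : ∀ S ∈ D, rkN M S = v := by
    intro S hS
    obtain ⟨_, h1, h2, h3⟩ := hDmem S hS
    exact rkN_eq_of_dep_of_girth hg h1 h2 h3
  have hex : ∀ S ∈ D, ∃ y ∈ gr M, y ∉ M.closure (S : Set α) := by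
    intro S hS
    exact exists_notMem_closure_of_rkN_eq (hDrk S hS) hrank
  let g : Finset α → Finset α := fun S =>
    if h : ∃ y ∈ gr M, y ∉ M.closure (S : Set α) then insert h.choose S else S
  have hgS : ∀ S ∈ D, ∃ y, y ∈ gr M ∧ y ∉ M.closure (S : Set α) ∧ y ∉ S ∧ g S = insert y S := by
    intro S hS
    have h := hex S hS
    refine ⟨h.choose, h.choose_spec.1, h.choose_spec.2, ?_, dif_pos h⟩
    intro hyS
    apply h.choose_spec.2
    have hSE : (S : Set α) ⊆ M.E := by rw [← coe_gr]; exact_mod_cast (hDmem S hS).2.1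
    exact M.subset_closure (S : Set α) hSE (Finset.mem_coe.2 hyS)
  have hgD : ∀ S ∈ D, g S ∈ L ∧ (g S).card = v + 2 := by
    intro S hS
    obtain ⟨y, hyg, hyc, hyS, hgy⟩ := hgS S hS
    obtain ⟨hSP, _, hSc, hSd⟩ := hDmem S hS
    rw [hgy]
    exact ⟨hL2 S hSP hSd y hyg hyc, by rw [Finset.card_insert_of_notMem hyS, hSc]⟩
  have hinj : Set.InjOn g (D : Set (Finset α)) := by
    intro S hS S' hS' hSS'
    obtain ⟨y, hyg, hyc, hyS, hgy⟩ := hgS S hS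
    obtain ⟨y', _, _, hy'S', hgy'⟩ := hgS S' hS'
    rw [hgy, hgy'] at hSS'
    obtain ⟨_, hSg, hSc, _⟩ := hDmem S hS
    obtain ⟨_, _, hS'c, _⟩ := hDmem S' hS'
    have hT : rkN M (insert y S) = v + 1 := by
      rw [rkN_insert_of_notMem_closure hyg hyc, hDrk S hS]
    exact eq_of_insert_eq_of_girth hg hSg hSc hS'c (hDrk S hS) (hDrk S' hS') hyS hy'S' hT hSS'
  have hI_sub : I ⊆ L := by
    intro S hS
    rw [hI, Finset.mem_filter] at hS
    exact hL1 S hS.1 hS.2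
  have himg : D.image g ⊆ L := by
    rw [Finset.image_subset_iff]
    intro S hS
    exact (hgD S hS).1
  have hdisj : Disjoint I (D.image g) := by
    rw [Finset.disjoint_left]
    intro S hSI hSim
    rw [hI, Finset.mem_filter] at hSI
    have hSc := (Finset.mem_powersetCard.1 (hP hSI.1)).2
    rw [Finset.mem_image] at hSim
    obtain ⟨S', hS', hS'S⟩ := hSim
    have := (hgD S' hS').2
    rw [hS'S] at this
    omega
  calc P.card = I.card + D.card := hID.symm
    _ = I.card + (D.image g).card := by rw [Finset.card_image_of_injOn hinj]
    _ = (I ∪ D.image g).card := (Finset.card_union_of_disjoint hdisj).symm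
    _ ≤ L.card := Finset.card_le_card (Finset.union_subset hI_sub himg)

/-- **The Boolean shadow is at most the matroid shadow** at girth `≥ v + 1`: for a family `𝒜` of `q`-subsets of the ground
set (`q + 1 ≤ v`, `ρ(E) ≥ v + 1`), `#(upAt E (v+1) 𝒜) ≤ #(shadowLevel M (v+1) 𝒜)`. -/
theorem card_upAt_le_card_shadowLevel {v : ℕ} (hg : ∀ T ⊆ M.E, T.encard ≤ v → M.Indep T)
    (hrank : ((v + 1 : ℕ) : ℕ∞) ≤ M.eRank) (𝒜 : Finset (Finset α)) :
    (Boolean.upAt (gr M) (v + 1) 𝒜).card ≤ (Shadow.shadowLevel M (v + 1) 𝒜).card := by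
  apply card_le_card_of_girth_family hg hrank
  · intro S hS
    rw [Boolean.mem_upAt] at hS
    exact Finset.mem_powersetCard.2 hS.1
  · intro S hS hSi
    rw [Boolean.mem_upAt] at hS
    rw [mem_shadowLevel, Profile.mem_levelSet]
    refine ⟨⟨hS.1.1, ?_⟩, hS.2⟩
    rw [hSi.eRk_eq_encard, Set.encard_coe_eq_coe_finsetCard, hS.1.2]
  · intro S hS hSd y hyg hyc
    rw [Boolean.mem_upAt] at hS
    obtain ⟨B, hB, hBS⟩ := hS.2
    rw [mem_shadowLevel, Profile.mem_levelSet]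
    refine ⟨⟨Finset.insert_subset hyg hS.1.1, ?_⟩, B, hB, hBS.trans (Finset.subset_insert y S)⟩
    rw [← Staged.coe_rkN, rkN_insert_of_notMem_closure hyg hyc,
      rkN_eq_of_dep_of_girth hg hS.1.1 hS.1.2 hSd]

/-- **THE HALL FORM `(H⁺_{q, v+1})` AT GIRTH `≥ v + 1`**: if every set of at most `v` points is independent and `q + 1 ≤ v`,
then for every family `𝒜` of rank-`q` sets, `Σ_{B ∈ 𝒜} price(B) ≤ #(shadowLevel M (v+1) 𝒜)` — C-033 at `(q, v + 1)`
(g7's `hallIneq_of_girth` needs every set of at most `v + 1` points independent). -/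
theorem hallIneq_of_girth_succ {q v : ℕ} (hg : ∀ T ⊆ M.E, T.encard ≤ v → M.Indep T) (hqv : q + 1 ≤ v) :
    Profile.HallIneq M q (v + 1) := by
  intro 𝒜 h𝒜
  rcases lt_or_ge M.eRank ((v + 1 : ℕ) : ℕ∞) with hlt | hge
  · rw [Finset.sum_eq_zero (fun B _ => price_eq_zero_of_eRank_lt hlt B)]
    exact Nat.cast_nonneg _
  · set n := (gr M).card with hn
    have hAq : 𝒜 ⊆ (gr M).powersetCard q := h𝒜.trans (Rq_subset_powersetCard hg (by omega))
    obtain ⟨k, hk⟩ : ∃ k, v + 1 = q + k := ⟨v + 1 - q, by omega⟩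
    have hnmp := Boolean.card_mul_choose_le_card_upAt_mul_choose hAq k
    rw [← hk] at hnmp
    by_cases hAe : 𝒜 = ∅
    · subst hAe
      simp only [Finset.sum_empty]
      exact Nat.cast_nonneg _
    · obtain ⟨B₀, hB₀⟩ := Finset.nonempty_iff_ne_empty.2 hAe
      have hqn : q ≤ n := by
        have h := Finset.mem_powersetCard.1 (hAq hB₀)
        rw [← h.2]; exact Finset.card_le_card h.1
      have hq : (0 : ℚ) < Nat.choose n q := by exact_mod_cast Nat.choose_pos hqn
      calc ∑ B ∈ 𝒜, Profile.price M q (v + 1) B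
          ≤ ∑ _B ∈ 𝒜, (Nat.choose n (v + 1) : ℚ) / (Nat.choose n q : ℚ) := by
            apply Finset.sum_le_sum
            intro B hB
            have hB' := Finset.mem_powersetCard.1 (hAq hB)
            exact price_le_of_card (by omega) hB'.1 hB'.2
        _ = (𝒜.card : ℚ) * ((Nat.choose n (v + 1) : ℚ) / (Nat.choose n q : ℚ)) := by
            rw [Finset.sum_const, nsmul_eq_mul]
        _ ≤ ((Boolean.upAt (gr M) (v + 1) 𝒜).card : ℚ) := by
            rw [← mul_div_assoc, div_le_iff₀ hq]
            exact_mod_cast hnmp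
        _ ≤ ((Shadow.shadowLevel M (v + 1) 𝒜).card : ℚ) := by
            exact_mod_cast card_upAt_le_card_shadowLevel hg hge 𝒜

/-- The row `(q, v + 1)` and its Hall form together, at girth `≥ v + 1`, `q + 1 ≤ v`. -/
theorem profileIneq_and_hallIneq_of_girth_succ {q v : ℕ} (hg : ∀ T ⊆ M.E, T.encard ≤ v → M.Indep T)
    (hqv : q + 1 ≤ v) : Profile.ProfileIneq M q (v + 1) ∧ Profile.HallIneq M q (v + 1) :=
  ⟨profileIneq_of_girth_succ hg hqv, hallIneq_of_girth_succ hg hqv⟩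

end GirthRows

end PercRepro
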